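import Literature.Barriers.AtomisticToContinuum.NoBVEstimatesMultiDFamilyBounds
import HarnessLib

/-!
# The family `W_δ`: sup bounds of `G(W_δ)`, equi-Lipschitz continuity in time, and sup-Cauchy
# smallness of `W_δ`, `∂W_δ`, `∂²W_δ` and of `∂ₜW_δ` as `δ → 0`

Brick B-ε, §2d, of the Kato existence programme for the symmetrizable branch of Rauch's Local
Existence Theorem (towards `Rauch1986_smallAmplitudeExpansionL2`). With the uniform bounds of
`NoBVEstimatesMultiDFamilyBounds.lean` and the interpolation of
`NoBVEstimatesMultiDSupSmallness.lean`, the family `W_δ(t) = ρ_δ ⋆ U_δ(t)` of regularised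
solutions is shown to be, on `[-T, T] × ℝᵈ` and under the smallness condition on the datum
[Majda1984, Ch. 2, Thm 2.1 (proof, Step 3)], [TaylorPDEIII2011, Ch. 16, §1, (1.20)–(1.22)]:

* `norm_cwd_gfield_le_of_sup`, `norm_cwd_moll_moll_le`, `norm_gfield_sub_le` — static sup bounds
  of `∂_c G(w)` and of `∂_c(ρ⋆ρ⋆g)`, and the pointwise Lipschitz bound of `G` in `(w, ∂w)`;
* `exists_time_lipschitz_Wfam` — **equi-Lipschitz in time**: `‖∂_c W_δ(t) - ∂_c W_δ(t')‖_∞ ≤ Λ|t - t'|`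
  for `|c| ≤ 2`, uniformly in `δ ∈ (0, 1]` and in the datum;
* `exists_sup_small_Wfam` — **sup-Cauchy smallness**: for every `ε > 0` there is `η > 0` such
  that `‖∂_c W_δ(t) - ∂_c W_{δ'}(t)‖_∞ ≤ ε` (`|c| ≤ 2`) as soon as the `L²`-Cauchy quantity
  `cConst e^{cRate T}(δ + δ')(1 + Σ‖∂ⱼu₀‖₂)` is `≤ η`;
* `exists_sup_small_dtWfam` — the same for the time derivatives
  `∂ₜW_δ(t) = -ρ_δ⋆ρ_δ⋆G(W_δ(t))`, with an extra `O(δ + δ')` from the mollification.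

Everything is proved; no named fact and no `sorry` is introduced.

## References

* [Majda1984] A. Majda, *Compressible Fluid Flow and Systems of Conservation Laws in Several
  Space Variables* (1984), Ch. 2, §2.1, Thm 2.1 (proof, Step 3).
* [TaylorPDEIII2011] M. E. Taylor, *Partial Differential Equations III*, 2nd ed. (2011), Ch. 16,
  §1, (1.20)–(1.22).
-/

noncomputable section

open MeasureTheory Set Function Filter Metric ContinuousLinearMap
open scoped ContDiff Topology ENNReal NNReal Convolution RealInnerProductSpace

namespace Literature.Barriers.AtomisticToContinuum

open Literature.Analysis.PDE Literature.Analysis.FunctionSpaces Literature.Analysis.ODE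

variable {d k : ℕ}

variable {M L : ℝ} {a : Fin d → EuclideanSpace ℝ (Fin k) → (EuclideanSpace ℝ (Fin k) →L[ℝ] EuclideanSpace ℝ (Fin k))}
  {b : EuclideanSpace ℝ (Fin k) → EuclideanSpace ℝ (Fin k)}
  {s : EuclideanSpace ℝ (Fin k) → (EuclideanSpace ℝ (Fin k) →L[ℝ] EuclideanSpace ℝ (Fin k))}

/-! ### Static sup bounds -/

/-- **Sup bound of `∂_c G(w)`** for `|c| ≤ n` from sup control of the word derivatives of `w` up
to order `n + 1` and sup bounds of the word derivatives of `aⱼ ∘ w`, `b ∘ w` up to order `n`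
(Leibniz, `cwd_gfield_eq`). [cite: Majda1984, Ch. 2 §2.1] -/
theorem norm_cwd_gfield_le_of_sup (hS : IsSymmSmoothCoeff M L a b s)
    {w : EuclideanSpace ℝ (Fin d) → EuclideanSpace ℝ (Fin k)} (hw : ContDiff ℝ ∞ w) {n : ℕ}
    {R Ca' Cb' : ℝ} (hR : 0 ≤ R) (hCa' : 0 ≤ Ca')
    (hsup : ∀ c : List (Fin d), c.length ≤ n + 1 → ∀ x, ‖cwd c w x‖ ≤ R)
    (hSa : ∀ (j : Fin d) (v : List (Fin d)), v.length ≤ n → ∀ x, ‖cwd v (fun y => a j (w y)) x‖ ≤ Ca')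
    (hSb : ∀ v : List (Fin d), v.length ≤ n → ∀ x, ‖cwd v (fun y => b (w y)) x‖ ≤ Cb')
    (c : List (Fin d)) (hc : c.length ≤ n) (x : EuclideanSpace ℝ (Fin d)) :
    ‖cwd c (gfield a b w) x‖ ≤ d * 2 ^ n * (Ca' * R) + Cb' := by
  rw [cwd_gfield_eq hS hw c]
  refine (norm_add_le _ _).trans (add_le_add ?_ (hSb c hc x))
  refine (norm_sum_le _ _).trans ?_
  have hterm : ∀ j : Fin d, ‖((splittings c).map fun p =>
      (ContinuousLinearMap.id ℝ (EuclideanSpace ℝ (Fin k) →L[ℝ] EuclideanSpace ℝ (Fin k)))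
        (cwd p.1 (fun y => a j (w y)) x) (cwd p.2 (cwd [j] w) x)).sum‖ ≤ 2 ^ n * (Ca' * R) := by
    intro j
    refine (norm_list_sum_le _).trans ?_
    rw [List.map_map]
    have hlen : (splittings c).length ≤ 2 ^ n := by
      rw [length_splittings]; exact Nat.pow_le_pow_right (by norm_num) hc
    calc ((splittings c).map (Norm.norm ∘ fun p =>
          (ContinuousLinearMap.id ℝ (EuclideanSpace ℝ (Fin k) →L[ℝ] EuclideanSpace ℝ (Fin k)))
            (cwd p.1 (fun y => a j (w y)) x) (cwd p.2 (cwd [j] w) x))).sum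
        ≤ ((splittings c).map fun _ => Ca' * R).sum := by
          refine List.sum_le_sum fun p hp => ?_
          have hl := length_add_length_of_mem_splittings hp
          rw [Function.comp_apply, ContinuousLinearMap.id_apply]
          refine (le_opNorm _ _).trans (mul_le_mul (hSa j p.1 (by omega) x) ?_ (norm_nonneg _) hCa')
          rw [← cwd_append]
          exact hsup _ (by simp; omega) x
      _ = (splittings c).length * (Ca' * R) := by rw [List.map_const', List.sum_replicate, nsmul_eq_mul]
      _ ≤ 2 ^ n * (Ca' * R) := mul_le_mul_of_nonneg_right (by exact_mod_cast hlen) (by positivity)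
  calc ∑ j, ‖((splittings c).map fun p =>
        (ContinuousLinearMap.id ℝ (EuclideanSpace ℝ (Fin k) →L[ℝ] EuclideanSpace ℝ (Fin k)))
          (cwd p.1 (fun y => a j (w y)) x) (cwd p.2 (cwd [j] w) x)).sum‖
      ≤ ∑ _j : Fin d, 2 ^ n * (Ca' * R) := Finset.sum_le_sum fun j _ => hterm j
    _ = d * 2 ^ n * (Ca' * R) := by simp; ring

/-- **`‖∂_c(ρ_δ ⋆ (ρ_δ ⋆ g))(x)‖ ≤ K`** when `‖∂_c g‖ ≤ K` everywhere (derivatives pass onto the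
smooth field; a probability kernel does not increase the sup norm). [cite: Evans2010, App. C.4 Thm. 7] -/
theorem norm_cwd_moll_moll_le {F : Type*} [NormedAddCommGroup F] [NormedSpace ℝ F] [CompleteSpace F]
    {δ : ℝ} (hδ : 0 < δ) {g : EuclideanSpace ℝ (Fin d) → F} (hg : ContDiff ℝ ∞ g)
    (c : List (Fin d)) {K : ℝ} (hK : ∀ y, ‖cwd c g y‖ ≤ K) (x : EuclideanSpace ℝ (Fin d)) :
    ‖cwd c (moll (Fin d) hδ ⋆[lsmul ℝ ℝ, volume] (moll (Fin d) hδ ⋆[lsmul ℝ ℝ, volume] g)) x‖ ≤ K := by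
  set ρ := moll (Fin d) hδ with hρ
  have hρg : ContDiff ℝ ∞ (ρ ⋆[lsmul ℝ ℝ, volume] g) :=
    contDiff_convolution_kernel (contDiff_moll hδ) (hasCompactSupport_moll hδ) hg.continuous.locallyIntegrable
  rw [cwd_convolution_eq_convolution_cwd (continuous_moll hδ) (hasCompactSupport_moll hδ) hρg,
    cwd_convolution_eq_convolution_cwd (continuous_moll hδ) (hasCompactSupport_moll hδ) hg]
  refine norm_normed_convolution_le (bump (Fin d) hδ) ?_ fun z _ => ?_
  · exact (hasCompactSupport_moll hδ).continuous_convolution_left _ (continuous_moll hδ)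
      (continuous_cwd hg c).locallyIntegrable
  · exact norm_normed_convolution_le (bump (Fin d) hδ) (continuous_cwd hg c) fun y _ => hK y

/-- **Pointwise Lipschitz bound of `G` in `(w, ∂w)`**:
`‖G(w₁)(x) - G(w₂)(x)‖ ≤ M Σⱼ‖∂ⱼw₁(x) - ∂ⱼw₂(x)‖ + (dMR + L)‖w₁(x) - w₂(x)‖` when `‖∂ⱼw₂‖ ≤ R`.
[cite: Majda1984, Ch. 2 §2.1] -/
theorem norm_gfield_sub_le (hS : IsSymmSmoothCoeff M L a b s)
    {w₁ w₂ : EuclideanSpace ℝ (Fin d) → EuclideanSpace ℝ (Fin k)} {R : ℝ}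
    (h2 : ∀ j x, ‖cwd [j] w₂ x‖ ≤ R) (x : EuclideanSpace ℝ (Fin d)) :
    ‖gfield a b w₁ x - gfield a b w₂ x‖ ≤
      M * ∑ j, ‖cwd [j] w₁ x - cwd [j] w₂ x‖ + (d * M * R + L) * ‖w₁ x - w₂ x‖ := by
  have hM0 : 0 ≤ M := hS.M_nonneg
  have key : ∀ j : Fin d, a j (w₁ x) (cwd [j] w₁ x) - a j (w₂ x) (cwd [j] w₂ x) =
      a j (w₁ x) (cwd [j] w₁ x - cwd [j] w₂ x) + (a j (w₁ x) - a j (w₂ x)) (cwd [j] w₂ x) :=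
    fun j => by rw [map_sub, sub_apply]; abel
  have hsplit : gfield a b w₁ x - gfield a b w₂ x =
      (∑ j, (a j (w₁ x) (cwd [j] w₁ x - cwd [j] w₂ x) + (a j (w₁ x) - a j (w₂ x)) (cwd [j] w₂ x))) +
        (b (w₁ x) - b (w₂ x)) := by
    simp only [gfield, ← Finset.sum_congr rfl fun j _ => key j, Finset.sum_sub_distrib]
    abel
  rw [hsplit]
  refine (norm_add_le _ _).trans ?_
  have hb : ‖b (w₁ x) - b (w₂ x)‖ ≤ L * ‖w₁ x - w₂ x‖ := hS.norm_b_sub_le _ _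
  have hs : ‖∑ j, (a j (w₁ x) (cwd [j] w₁ x - cwd [j] w₂ x) + (a j (w₁ x) - a j (w₂ x)) (cwd [j] w₂ x))‖
      ≤ ∑ j, (M * ‖cwd [j] w₁ x - cwd [j] w₂ x‖ + M * ‖w₁ x - w₂ x‖ * R) := by
    refine (norm_sum_le _ _).trans (Finset.sum_le_sum fun j _ => (norm_add_le _ _).trans (add_le_add ?_ ?_))
    · exact (le_opNorm _ _).trans (mul_le_mul_of_nonneg_right (hS.norm_a j _) (norm_nonneg _))
    · exact (le_opNorm _ _).trans (mul_le_mul (hS.norm_a_sub_le j _ _) (h2 j x) (norm_nonneg _)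
        (by positivity))
  refine (add_le_add hs hb).trans (le_of_eq ?_)
  rw [Finset.sum_add_distrib, Finset.mul_sum]
  simp only [Finset.sum_const, Finset.card_univ, Fintype.card_fin, nsmul_eq_mul]
  ring

/-- `‖f - g‖₂ ≤ ‖f‖₂ + ‖g‖₂` for `f, g ∈ L²`. [folklore] -/
theorem l2norm_sub_le {F : Type*} [NormedAddCommGroup F] {f g : EuclideanSpace ℝ (Fin d) → F}
    (hf : MemLp f 2 (volume : Measure (EuclideanSpace ℝ (Fin d))))
    (hg : MemLp g 2 (volume : Measure (EuclideanSpace ℝ (Fin d)))) :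
    MemLp (fun x => f x - g x) 2 (volume : Measure (EuclideanSpace ℝ (Fin d))) ∧
      l2norm (fun x => f x - g x) ≤ l2norm f + l2norm g := by
  have heq : (fun x => f x - g x) = f + (-g) := by funext x; simp [sub_eq_add_neg]
  have hneg : l2norm (-g) = l2norm g := by
    rw [l2norm_def, l2norm_def, eLpNorm_neg]
  rw [heq]
  refine ⟨hf.add hg.neg, (l2norm_add_le hf hg.neg).trans (le_of_eq ?_)⟩
  rw [hneg]

/-! ### Equi-Lipschitz continuity in time -/

section Family

variable (hS : IsSymmSmoothCoeff M L a b s) {m : ℕ} (hm : 4 * (d + 1) ≤ m)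

/-- The order hypothesis of this file: `4(d+1) + 1 ≤ m`. [folklore] -/
private theorem order_aux (hm1 : 4 * (d + 1) + 1 ≤ m) : 3 + 2 * (d + 1) ≤ m ∧ 2 + 2 * (d + 1) + 1 ≤ m := by
  omega

/-- **Equi-Lipschitz continuity in time of the word derivatives of order `≤ 2`**: there is
`Λ ≥ 0` (depending on the coefficients, `d`, `k`, `m` only) with
`‖∂_c W_δ(t)(x) - ∂_c W_δ(t')(x)‖ ≤ Λ |t - t'|` for `|c| ≤ 2`, `δ ∈ (0, 1]`, `t, t' ∈ [-T, T]`,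
whenever `eConst e^{eRate T} ℰ_m(u₀) < 1` (the evolution equation `hasDerivAt_cwd_Wfam` and the sup
bound of `∂_c(ρρG(W_δ))`). [cite: Majda1984, Ch. 2 §2.1, Thm 2.1 (proof, Step 3)] -/
theorem exists_time_lipschitz_Wfam (hm1 : 4 * (d + 1) + 1 ≤ m) :
    ∃ Λ : ℝ, 0 ≤ Λ ∧ ∀ {u₀ : EuclideanSpace ℝ (Fin d) → EuclideanSpace ℝ (Fin k)}
      (hu₀ : ContDiff ℝ ∞ u₀) (hu₀c : HasCompactSupport u₀) {T : ℝ}, 0 ≤ T →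
      eConst hS hm * Real.exp (eRate hS hm * T) * wordEnergy m u₀ < 1 →
      ∀ {δ : ℝ} (hδ : 0 < δ), δ ≤ 1 → ∀ t ∈ Icc (-T) T, ∀ t' ∈ Icc (-T) T,
        ∀ c : List (Fin d), c.length ≤ 2 → ∀ x,
          ‖cwd c (Wfam hS.toIsTameCoeff hu₀ hu₀c δ t) x - cwd c (Wfam hS.toIsTameCoeff hu₀ hu₀c δ t') x‖ ≤
            Λ * |t - t'| := by
  -- the constants
  set R₀ : ℝ := Real.sqrt (supConst (Fin d) (EuclideanSpace ℝ (Fin k))) with hR₀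
  have hR₀0 : 0 ≤ R₀ := Real.sqrt_nonneg _
  have hSa0 := fun j : Fin d => exists_sup_bound_cwd_comp_whole (ι := Fin d) 2 (hS.smooth_a j) (hS.bdd_a j) R₀
  choose Ca' hCa'0 hCa' using hSa0
  obtain ⟨Cb', hCb'0, hCb'⟩ := exists_sup_bound_cwd_comp_whole (ι := Fin d) 2 hS.smooth_b hS.bdd_b R₀
  set CA' : ℝ := ∑ j, Ca' j with hCA'
  have hCA'0 : 0 ≤ CA' := Finset.sum_nonneg fun j _ => hCa'0 j
  have hleA' : ∀ j, Ca' j ≤ CA' := fun j =>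
    Finset.single_le_sum (f := Ca') (fun i _ => hCa'0 i) (Finset.mem_univ j)
  refine ⟨d * 2 ^ 2 * (CA' * R₀) + Cb', by positivity, ?_⟩
  intro u₀ hu₀ hu₀c T hT hsm δ hδ hδ1 t ht t' ht' c hc x
  obtain ⟨h3, -⟩ := order_aux hm1
  -- sup control of `W_δ(τ)` up to order 3 on `[-T, T]`
  have hsup : ∀ τ ∈ Icc (-T) T, ∀ c' : List (Fin d), c'.length ≤ 2 + 1 → ∀ y,
      ‖cwd c' (Wfam hS.toIsTameCoeff hu₀ hu₀c δ τ) y‖ ≤ R₀ := fun τ hτ c' hc' y =>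
    (norm_cwd_Wfam_le_Rdat hS hm hu₀ hu₀c hT hsm hδ hδ1 hτ c' (by omega) y).trans
      (Rdat_le_sqrt_supConst hS hm hsm)
  -- the derivative bound along `[-T, T]`
  have hder : ∀ τ ∈ Icc (-T) T, ‖-cwd c (moll (Fin d) hδ ⋆[lsmul ℝ ℝ, volume]
      (moll (Fin d) hδ ⋆[lsmul ℝ ℝ, volume] gfield a b (Wfam hS.toIsTameCoeff hu₀ hu₀c δ τ))) x‖ ≤
      d * 2 ^ 2 * (CA' * R₀) + Cb' := by
    intro τ hτ
    rw [norm_neg]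
    have hWs := contDiff_Wfam hS.toIsTameCoeff hu₀ hu₀c hδ τ
    have hsup1 : ∀ c' : List (Fin d), 1 ≤ c'.length → c'.length ≤ 2 → ∀ y,
        ‖cwd c' (Wfam hS.toIsTameCoeff hu₀ hu₀c δ τ) y‖ ≤ R₀ := fun c' _ hc' y => hsup τ hτ c' (by omega) y
    refine norm_cwd_moll_moll_le hδ (contDiff_gfield hS hWs) c (fun y => ?_) x
    exact norm_cwd_gfield_le_of_sup hS hWs hR₀0 hCA'0 (hsup τ hτ)
      (fun j v hv z => (hCa' j _ hWs hsup1 v hv z).trans (hleA' j))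
      (fun v hv z => hCb' _ hWs hsup1 v hv z) c hc y
  -- mean value theorem on the segment
  have hmvt := (convex_Icc (-T) T).norm_image_sub_le_of_norm_hasDerivWithin_le
    (f := fun τ => cwd c (Wfam hS.toIsTameCoeff hu₀ hu₀c δ τ) x)
    (fun τ _ => (hasDerivAt_cwd_Wfam hS.toIsTameCoeff hu₀ hu₀c hδ c τ x).hasDerivWithinAt)
    hder ht' ht
  rw [Real.norm_eq_abs] at hmvt
  exact hmvt

/-! ### Sup-Cauchy smallness as `δ → 0` -/

/-- **Sup-Cauchy smallness of `W_δ`, `∂W_δ`, `∂²W_δ`.** For every `ε > 0` there is `η > 0`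
(depending on the coefficients, `d`, `k`, `m` only) such that, whenever
`eConst e^{eRate T} ℰ_m(u₀) < 1`, `δ, δ' ∈ (0, 1]`, `|t| ≤ T` and the `L²`-Cauchy quantity satisfies
`cConst e^{cRate T}(δ + δ')(1 + Σⱼ‖∂ⱼu₀‖₂) ≤ η`, then
`‖∂_c W_δ(t)(x) - ∂_c W_{δ'}(t)(x)‖ ≤ ε` for all `x` and `|c| ≤ 2` (interpolation,
`exists_norm_cwd_le`). [cite: Majda1984, Ch. 2 §2.1, Thm 2.1 (proof, Step 3)] -/
theorem exists_sup_small_Wfam (hm1 : 4 * (d + 1) + 1 ≤ m) {ε : ℝ} (hε : 0 < ε) :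
    ∃ η : ℝ, 0 < η ∧ ∀ {u₀ : EuclideanSpace ℝ (Fin d) → EuclideanSpace ℝ (Fin k)}
      (hu₀ : ContDiff ℝ ∞ u₀) (hu₀c : HasCompactSupport u₀) {T : ℝ}, 0 ≤ T →
      eConst hS hm * Real.exp (eRate hS hm * T) * wordEnergy m u₀ < 1 →
      ∀ {δ δ' : ℝ} (hδ : 0 < δ), δ ≤ 1 → ∀ (hδ' : 0 < δ'), δ' ≤ 1 → ∀ t ∈ Icc (-T) T,
        cConst hS hm * Real.exp (cRate hS hm * T) * (δ + δ') * (1 + ∑ j, l2norm (cwd [j] u₀)) ≤ η →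
        ∀ c : List (Fin d), c.length ≤ 2 → ∀ x,
          ‖cwd c (Wfam hS.toIsTameCoeff hu₀ hu₀c δ t) x - cwd c (Wfam hS.toIsTameCoeff hu₀ hu₀c δ' t) x‖ ≤ ε := by
  obtain ⟨η, hη0, hη⟩ := exists_norm_cwd_le (ι := Fin d) (V := EuclideanSpace ℝ (Fin k)) 2 ε hε 2 (by norm_num)
  refine ⟨η, hη0, ?_⟩
  intro u₀ hu₀ hu₀c T hT hsm δ δ' hδ hδ1 hδ' hδ'1 t ht hsmall c hc x
  obtain ⟨-, h5⟩ := order_aux hm1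
  set W₁ := Wfam hS.toIsTameCoeff hu₀ hu₀c δ t with hW₁
  set W₂ := Wfam hS.toIsTameCoeff hu₀ hu₀c δ' t with hW₂
  have hW₁s : ContDiff ℝ ∞ W₁ := contDiff_Wfam hS.toIsTameCoeff hu₀ hu₀c hδ t
  have hW₂s : ContDiff ℝ ∞ W₂ := contDiff_Wfam hS.toIsTameCoeff hu₀ hu₀c hδ' t
  set g : EuclideanSpace ℝ (Fin d) → EuclideanSpace ℝ (Fin k) := fun y => W₁ y - W₂ y with hg
  have hgs : ContDiff ℝ ∞ g := hW₁s.sub hW₂s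
  have hcwdg : ∀ c' : List (Fin d), cwd c' g = fun y => cwd c' W₁ y - cwd c' W₂ y := fun c' =>
    cwd_fun_sub hW₁s hW₂s c'
  have hmem : ∀ c' : List (Fin d), MemLp (cwd c' g) 2 (volume : Measure (EuclideanSpace ℝ (Fin d))) := fun c' => by
    rw [hcwdg]
    exact (l2norm_sub_le (memLp_cwd_Wfam hS hu₀ hu₀c hδ t c') (memLp_cwd_Wfam hS hu₀ hu₀c hδ' t c')).1
  have hbdd : ∀ c' : List (Fin d), ∃ C : ℝ, ∀ y, ‖cwd c' g y‖ ≤ C := fun c' => by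
    obtain ⟨C₁, hC₁⟩ := exists_bound_cwd_Wfam hS hu₀ hu₀c hδ t c'
    obtain ⟨C₂, hC₂⟩ := exists_bound_cwd_Wfam hS hu₀ hu₀c hδ' t c'
    refine ⟨C₁ + C₂, fun y => ?_⟩
    rw [hcwdg]
    exact (norm_sub_le _ _).trans (add_le_add (hC₁ y) (hC₂ y))
  have hB : ∀ c' : List (Fin d), c'.length ≤ 2 + 2 * (Fintype.card (Fin d) + 1) + 1 →
      l2norm (cwd c' g) ≤ 2 := by
    intro c' hc'
    rw [Fintype.card_fin] at hc'
    rw [hcwdg]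
    have h1 := l2norm_cwd_Wfam_le_one hS hm hu₀ hu₀c hT hsm hδ hδ1 ht c' (by omega)
    have h2 := l2norm_cwd_Wfam_le_one hS hm hu₀ hu₀c hT hsm hδ' hδ'1 ht c' (by omega)
    have h := (l2norm_sub_le h1.1 h2.1).2
    linarith [h1.2, h2.2]
  have hsmall' : l2norm g ≤ η :=
    (l2norm_Wfam_sub_le hS hm hu₀ hu₀c hT hsm hδ hδ1 hδ' hδ'1 ht).trans hsmall
  have h := hη g hgs hmem hbdd hB hsmall' c hc x
  rw [hcwdg] at h
  exact h

set_option maxHeartbeats 400000 in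
/-- **Sup-Cauchy smallness of the time derivatives** `∂ₜW_δ(t) = -ρ_δ⋆ρ_δ⋆G(W_δ(t))`: for every
`ε > 0` there are `η > 0` and `θ > 0` (coefficients, `d`, `k`, `m` only) such that under the
smallness condition, for `δ, δ' ∈ (0, 1]` with `δ + δ' ≤ θ`, `|t| ≤ T` and `L²`-Cauchy quantity
`≤ η`: `‖(ρ_δ⋆ρ_δ⋆G(W_δ(t)))(x) - (ρ_{δ'}⋆ρ_{δ'}⋆G(W_{δ'}(t)))(x)‖ ≤ ε` (mollification rate
`norm_moll_moll_sub_self_le` twice and the Lipschitz bound of `G`).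
[cite: TaylorPDEIII2011, Ch. 16 §1, (1.21)–(1.22)] -/
theorem exists_sup_small_dtWfam (hm1 : 4 * (d + 1) + 1 ≤ m) {ε : ℝ} (hε : 0 < ε) :
    ∃ η θ : ℝ, 0 < η ∧ 0 < θ ∧ ∀ {u₀ : EuclideanSpace ℝ (Fin d) → EuclideanSpace ℝ (Fin k)}
      (hu₀ : ContDiff ℝ ∞ u₀) (hu₀c : HasCompactSupport u₀) {T : ℝ}, 0 ≤ T →
      eConst hS hm * Real.exp (eRate hS hm * T) * wordEnergy m u₀ < 1 →
      ∀ {δ δ' : ℝ} (hδ : 0 < δ), δ ≤ 1 → ∀ (hδ' : 0 < δ'), δ' ≤ 1 → δ + δ' ≤ θ → ∀ t ∈ Icc (-T) T,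
        cConst hS hm * Real.exp (cRate hS hm * T) * (δ + δ') * (1 + ∑ j, l2norm (cwd [j] u₀)) ≤ η →
        ∀ x, ‖(moll (Fin d) hδ ⋆[lsmul ℝ ℝ, volume] (moll (Fin d) hδ ⋆[lsmul ℝ ℝ, volume]
              gfield a b (Wfam hS.toIsTameCoeff hu₀ hu₀c δ t))) x -
            (moll (Fin d) hδ' ⋆[lsmul ℝ ℝ, volume] (moll (Fin d) hδ' ⋆[lsmul ℝ ℝ, volume]
              gfield a b (Wfam hS.toIsTameCoeff hu₀ hu₀c δ' t))) x‖ ≤ ε := by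
  -- constants for the sup bound of `∂ᵢG(W_δ)`
  set R₀ : ℝ := Real.sqrt (supConst (Fin d) (EuclideanSpace ℝ (Fin k))) with hR₀
  have hR₀0 : 0 ≤ R₀ := Real.sqrt_nonneg _
  have hSa0 := fun j : Fin d => exists_sup_bound_cwd_comp_whole (ι := Fin d) 1 (hS.smooth_a j) (hS.bdd_a j) R₀
  choose Ca' hCa'0 hCa' using hSa0
  obtain ⟨Cb', hCb'0, hCb'⟩ := exists_sup_bound_cwd_comp_whole (ι := Fin d) 1 hS.smooth_b hS.bdd_b R₀
  set CA' : ℝ := ∑ j, Ca' j with hCA'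
  have hCA'0 : 0 ≤ CA' := Finset.sum_nonneg fun j _ => hCa'0 j
  have hleA' : ∀ j, Ca' j ≤ CA' := fun j =>
    Finset.single_le_sum (f := Ca') (fun i _ => hCa'0 i) (Finset.mem_univ j)
  have hM0 : 0 ≤ M := hS.M_nonneg
  have hL0 : 0 ≤ L := hS.L_nonneg
  have hd0 : (0 : ℝ) ≤ d := Nat.cast_nonneg d
  -- `K_G` bounds `‖∂ᵢ G(W_δ(t))‖`
  obtain ⟨KG, hKG⟩ : ∃ x : ℝ, x = d * 2 ^ 1 * (CA' * R₀) + Cb' := ⟨_, rfl⟩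
  have hKG0 : 0 ≤ KG := by rw [hKG]; positivity
  -- the Lipschitz constant of `G` in the sup norms of orders `0, 1`
  obtain ⟨LG, hLG⟩ : ∃ x : ℝ, x = M * d + (d * M * R₀ + L) := ⟨_, rfl⟩
  have hLG0 : 0 ≤ LG := by rw [hLG]; positivity
  -- smallness of `W_δ - W_{δ'}` up to order `1`, at level `ε₁`
  set ε₁ : ℝ := ε / (3 * (LG + 1)) with hε₁
  have hε₁0 : 0 < ε₁ := by positivity
  obtain ⟨η, hη0, hη⟩ := exists_sup_small_Wfam hS hm hm1 hε₁0
  set θ : ℝ := ε / (3 * (2 * d * KG + 1)) with hθ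
  have hθ0 : 0 < θ := by positivity
  refine ⟨η, θ, hη0, hθ0, ?_⟩
  intro u₀ hu₀ hu₀c T hT hsm δ δ' hδ hδ1 hδ' hδ'1 hδθ t ht hsmall x
  obtain ⟨h3, -⟩ := order_aux hm1
  set W₁ := Wfam hS.toIsTameCoeff hu₀ hu₀c δ t with hW₁
  set W₂ := Wfam hS.toIsTameCoeff hu₀ hu₀c δ' t with hW₂
  set G₁ := gfield a b W₁ with hG₁
  set G₂ := gfield a b W₂ with hG₂
  have hW₁s : ContDiff ℝ ∞ W₁ := contDiff_Wfam hS.toIsTameCoeff hu₀ hu₀c hδ t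
  have hW₂s : ContDiff ℝ ∞ W₂ := contDiff_Wfam hS.toIsTameCoeff hu₀ hu₀c hδ' t
  have hG₁s : ContDiff ℝ ∞ G₁ := contDiff_gfield hS hW₁s
  have hG₂s : ContDiff ℝ ∞ G₂ := contDiff_gfield hS hW₂s
  -- sup control up to order `2` of both fields
  have hsup₁ : ∀ c' : List (Fin d), c'.length ≤ 1 + 1 → ∀ y, ‖cwd c' W₁ y‖ ≤ R₀ := fun c' hc' y =>
    (norm_cwd_Wfam_le_Rdat hS hm hu₀ hu₀c hT hsm hδ hδ1 ht c' (by omega) y).trans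
      (Rdat_le_sqrt_supConst hS hm hsm)
  have hsup₂ : ∀ c' : List (Fin d), c'.length ≤ 1 + 1 → ∀ y, ‖cwd c' W₂ y‖ ≤ R₀ := fun c' hc' y =>
    (norm_cwd_Wfam_le_Rdat hS hm hu₀ hu₀c hT hsm hδ' hδ'1 ht c' (by omega) y).trans
      (Rdat_le_sqrt_supConst hS hm hsm)
  -- `‖∂ᵢGᵢ‖ ≤ K_G`
  have hKG₁ : ∀ i y, ‖cwd [i] G₁ y‖ ≤ KG := fun i y => by
    rw [hKG]
    exact norm_cwd_gfield_le_of_sup hS hW₁s hR₀0 hCA'0 hsup₁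
      (fun j v hv z => (hCa' j _ hW₁s (fun c' _ hc' w => hsup₁ c' (by omega) w) v hv z).trans (hleA' j))
      (fun v hv z => hCb' _ hW₁s (fun c' _ hc' w => hsup₁ c' (by omega) w) v hv z) [i] (by simp) y
  have hKG₂ : ∀ i y, ‖cwd [i] G₂ y‖ ≤ KG := fun i y => by
    rw [hKG]
    exact norm_cwd_gfield_le_of_sup hS hW₂s hR₀0 hCA'0 hsup₂
      (fun j v hv z => (hCa' j _ hW₂s (fun c' _ hc' w => hsup₂ c' (by omega) w) v hv z).trans (hleA' j))
      (fun v hv z => hCb' _ hW₂s (fun c' _ hc' w => hsup₂ c' (by omega) w) v hv z) [i] (by simp) y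
  -- the three pieces
  have hp1 : ‖(moll (Fin d) hδ ⋆[lsmul ℝ ℝ, volume] (moll (Fin d) hδ ⋆[lsmul ℝ ℝ, volume] G₁)) x - G₁ x‖ ≤
      2 * δ * (d * KG) := by
    have h := norm_moll_moll_sub_self_le hδ hG₁s (K := fun _ => KG) (fun i y => hKG₁ i y) x
    simpa [Finset.sum_const, Finset.card_univ, Fintype.card_fin] using h
  have hp3 : ‖(moll (Fin d) hδ' ⋆[lsmul ℝ ℝ, volume] (moll (Fin d) hδ' ⋆[lsmul ℝ ℝ, volume] G₂)) x - G₂ x‖ ≤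
      2 * δ' * (d * KG) := by
    have h := norm_moll_moll_sub_self_le hδ' hG₂s (K := fun _ => KG) (fun i y => hKG₂ i y) x
    simpa [Finset.sum_const, Finset.card_univ, Fintype.card_fin] using h
  have hsmallW : ∀ c' : List (Fin d), c'.length ≤ 2 → ∀ y, ‖cwd c' W₁ y - cwd c' W₂ y‖ ≤ ε₁ :=
    fun c' hc' y => hη hu₀ hu₀c hT hsm hδ hδ1 hδ' hδ'1 t ht hsmall c' hc' y
  have hp2 : ‖G₁ x - G₂ x‖ ≤ LG * ε₁ := by
    refine (norm_gfield_sub_le hS (fun j y => hsup₂ [j] (by simp) y) x).trans ?_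
    have h0 : ‖W₁ x - W₂ x‖ ≤ ε₁ := by simpa using hsmallW [] (by simp) x
    have h1 : ∑ j, ‖cwd [j] W₁ x - cwd [j] W₂ x‖ ≤ d * ε₁ := by
      calc ∑ j, ‖cwd [j] W₁ x - cwd [j] W₂ x‖ ≤ ∑ _j : Fin d, ε₁ :=
            Finset.sum_le_sum fun j _ => hsmallW [j] (by simp) x
        _ = d * ε₁ := by simp
    rw [hLG]
    nlinarith [mul_le_mul_of_nonneg_left h1 hM0, mul_le_mul_of_nonneg_left h0 (by positivity : 0 ≤ d * M * R₀ + L)]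
  -- assembling
  have hsplit : (moll (Fin d) hδ ⋆[lsmul ℝ ℝ, volume] (moll (Fin d) hδ ⋆[lsmul ℝ ℝ, volume] G₁)) x -
      (moll (Fin d) hδ' ⋆[lsmul ℝ ℝ, volume] (moll (Fin d) hδ' ⋆[lsmul ℝ ℝ, volume] G₂)) x =
      ((moll (Fin d) hδ ⋆[lsmul ℝ ℝ, volume] (moll (Fin d) hδ ⋆[lsmul ℝ ℝ, volume] G₁)) x - G₁ x) +
        (G₁ x - G₂ x) -
        ((moll (Fin d) hδ' ⋆[lsmul ℝ ℝ, volume] (moll (Fin d) hδ' ⋆[lsmul ℝ ℝ, volume] G₂)) x - G₂ x) := by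
    abel
  rw [hsplit]
  have hδsum : 2 * δ * (d * KG) + 2 * δ' * (d * KG) ≤ ε / 3 := by
    have h1 : 2 * δ * (d * KG) + 2 * δ' * (d * KG) = (δ + δ') * (2 * d * KG) := by ring
    rw [h1]
    calc (δ + δ') * (2 * d * KG) ≤ θ * (2 * d * KG) := mul_le_mul_of_nonneg_right hδθ (by positivity)
      _ ≤ ε / 3 := by
          rw [hθ, div_mul_eq_mul_div, div_le_iff₀ (by positivity)]
          nlinarith [mul_nonneg hd0 hKG0, hε.le]
  have hmid : LG * ε₁ ≤ ε / 3 := by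
    rw [hε₁, mul_div_assoc', div_le_iff₀ (by positivity)]
    nlinarith [hε.le]
  calc ‖((moll (Fin d) hδ ⋆[lsmul ℝ ℝ, volume] (moll (Fin d) hδ ⋆[lsmul ℝ ℝ, volume] G₁)) x - G₁ x) +
        (G₁ x - G₂ x) -
        ((moll (Fin d) hδ' ⋆[lsmul ℝ ℝ, volume] (moll (Fin d) hδ' ⋆[lsmul ℝ ℝ, volume] G₂)) x - G₂ x)‖
      ≤ ‖(moll (Fin d) hδ ⋆[lsmul ℝ ℝ, volume] (moll (Fin d) hδ ⋆[lsmul ℝ ℝ, volume] G₁)) x - G₁ x‖ +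
          ‖G₁ x - G₂ x‖ +
          ‖(moll (Fin d) hδ' ⋆[lsmul ℝ ℝ, volume] (moll (Fin d) hδ' ⋆[lsmul ℝ ℝ, volume] G₂)) x - G₂ x‖ :=
        (norm_sub_le _ _).trans (add_le_add (norm_add_le _ _) le_rfl)
    _ ≤ 2 * δ * (d * KG) + LG * ε₁ + 2 * δ' * (d * KG) := add_le_add (add_le_add hp1 hp2) hp3
    _ ≤ ε := by linarith

end Family

end Literature.Barriers.AtomisticToContinuum

end
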